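import Summits.ResolutionOfSingularities.ResolutionOfSingularities.Theorems.PurelyInseparableDim4ResConeKTwoPrimeLedger
import Summits.ResolutionOfSingularities.ResolutionOfSingularities.Theorems.PurelyInseparableDim4ResConeSubTwoShadeTail
import HarnessLib
import HarnessLib.Audit.Tags

/-!
# Purely inseparable four-folds — THE K2(p) LEDGER, v1: the two TOP binary-cone shades are gone for every prime —
# K2(p) ⟺ the `2·(p − 3) − 2` tails TAIL(p, d, e) with `(d, e) ∉ {(p−1, 2), (p−2, 2)}` (cell `res-dim4-pi`, K2(p) lane holder's
# socket of record after `…ResConePrimeShadeTail` and `…ResConeSubTwoShadeTail`)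

[OURS · counted 0 · cell `res-dim4-pi` · K2(p) lane holder res-dim4-p-12 g5 (v0/v0.1 = `…ResConeKTwoPrimeLedger`, p710010).]
**HONEST LABEL.**  BOOKKEEPING about OUR MODEL (the coordinate point-blow-up walk `Step0 p` with cleaning on presented states
`(F, r, exc)` of `z^p + F(x₁..x₄)`, ISOLATED regime), composing two KILLS of record: TAIL(p, p−1, 2) = ∅
(`no_primeShade_binaryCone_tail`) and TAIL(p, p−2, 2) = ∅ (`no_subTwoShade_binaryCone_tail`), every prime.  It proves NO further
case: nothing here proves `NoAboveFloorTrap p p` for any `p ≥ 7`, `NoIsolatedTrap p p`, CJS Key Theorem 6.40 or resolution of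
singularities in dimension ≥ 4 / characteristic `p` — NOT proved.  AI kernel work, weaker than expert review.

* `noAboveFloorTrap_iff_lowTails (p)` — **K2(p) ⟺ TAIL(p, d, e) = ∅ for `3 ≤ d < p`, `e ∈ {2, 3}`, EXCEPT the two binary-cone slots
  `(p−1, 2)` and `(p−2, 2)`** which are theorems: `2·(p − 3) − 2` statements for `p ≥ 5` — SIX at `p = 7` (TAIL(7,3,2), TAIL(7,4,2),
  TAIL(7,3,3), TAIL(7,4,3), TAIL(7,5,3), TAIL(7,6,3)); at `p = 5` the binary-cone side is EMPTY (TAIL-B and TAIL-D re-proved by the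
  tracker) and only the two power cones (5,3,3)/(5,4,3) remain, as the K27 ledger had it.
* `noAboveFloorTrap_of_lowTails (p)` — the direction the lane uses.

[cite: CossartJannsenSaito2020, Thm. 3.14, Thm. 13.7] [cite: HauserPerlega2019PRIMS, §2 (transform D′ of D)]
bears_on: LADDER-RESOLUTION:D157-DOOR2 (res-dim4-pi · K2(p) ledger ∀ p, v1: top two binary-cone shades closed).  Supports
stmt-ResolutionOfSingularities-16155 (helper).
-/

set_option linter.dupNamespace false -- mandated namespace of this single-conjunct summit

noncomputable section

namespace Summit.ResolutionOfSingularities.ResolutionOfSingularities.Theorems.PIDim4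

namespace ResCone

open MvPolynomial
open Literature.AlgebraicGeometry.Resolution
open Literature.AlgebraicGeometry.Resolution.CentreBlowup
open Literature.AlgebraicGeometry.Resolution.Hauser2010
open Literature.AlgebraicGeometry.Resolution.HauserPerlega2019
open RidgeBudget (NoAboveFloorTrap)

/-- **THE K2(p) LEDGER, v1 (every prime `p`): the top two binary-cone shades are theorems.**  `NoAboveFloorTrap p p` iff, for every
field of characteristic `p`, every high tame tail TAIL(p, d, e) with `3 ≤ d < p`, `e ∈ {2, 3}` and `(d, e) ∉ {(p−1, 2), (p−2, 2)}` is
empty — v0 `noAboveFloorTrap_iff_highTails` with the slots `(p−1, 2)` and `(p−2, 2)` discharged by `no_primeShade_binaryCone_tail`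
and `no_subTwoShade_binaryCone_tail`.  SIX statements at `p = 7`. [OURS · bookkeeping over two kills of record]
[cite: CossartJannsenSaito2020, Thm. 3.14, Thm. 13.7] -/
theorem noAboveFloorTrap_iff_lowTails (p : ℕ) [Fact p.Prime] :
    NoAboveFloorTrap p p ↔ ∀ (K : Type) [Field K] [CharP K p] [DecidableEq K] (d e : ℕ),
      3 ≤ d → d < p → (e = 2 ∨ e = 3) → ¬ (e = 2 ∧ (d + 1 = p ∨ d + 2 = p)) →
      ∀ (c : ℕ → State K) (j : ℕ → Fin 4) (b : ℕ → Fin 4 → K),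
        (∀ k, IsIsolated p (c k).F ∧ Step0 p (c k) (c (k + 1))) → FreeTail.IsWitnessedChain p c j b →
        (∀ e' ∈ (c 0).F.support, (c 0).r ≤ e') → (∀ k, ordZero (c k).F ≠ p) →
        ∀ k₀ : ℕ, (∀ k, k₀ ≤ k → (c k).shade = (d : ℕ∞)) →
          (∀ k, k₀ ≤ k → Module.finrank K (resVertex (c k)) = e) → False := by
  rw [noAboveFloorTrap_iff_highTails]
  refine forall_congr' fun K => forall_congr' fun _ => forall_congr' fun _ => forall_congr' fun _ => ?_
  constructor
  · intro h d e hd3 hdp he _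
    exact h d e hd3 hdp he
  · intro h d e hd3 hdp he c j b hc hw hr0 hfloor k₀ hshade hrk
    by_cases htop : e = 2 ∧ (d + 1 = p ∨ d + 2 = p)
    · obtain ⟨rfl, hd | hd⟩ := htop
      · exact no_primeShade_binaryCone_tail p hc hw hr0 hfloor hd hshade hrk
      · exact no_subTwoShade_binaryCone_tail p hc hw hr0 hfloor hd hshade hrk
    · exact h d e hd3 hdp he htop c j b hc hw hr0 hfloor k₀ hshade hrk

/-- **K2(p) FROM THE LOW TAILS** (the direction the lane uses; every prime `p`): per-`(d, e)` kills for `3 ≤ d < p`, `e ∈ {2, 3}`,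
`(d, e) ∉ {(p−1, 2), (p−2, 2)}` give `NoAboveFloorTrap p p`. [OURS · bookkeeping] [cite: CossartJannsenSaito2020, Thm. 3.14] -/
theorem noAboveFloorTrap_of_lowTails (p : ℕ) [Fact p.Prime]
    (h : ∀ (K : Type) [Field K] [CharP K p] [DecidableEq K] (d e : ℕ),
      3 ≤ d → d < p → (e = 2 ∨ e = 3) → ¬ (e = 2 ∧ (d + 1 = p ∨ d + 2 = p)) →
      ∀ (c : ℕ → State K) (j : ℕ → Fin 4) (b : ℕ → Fin 4 → K),
        (∀ k, IsIsolated p (c k).F ∧ Step0 p (c k) (c (k + 1))) → FreeTail.IsWitnessedChain p c j b →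
        (∀ e' ∈ (c 0).F.support, (c 0).r ≤ e') → (∀ k, ordZero (c k).F ≠ p) →
        ∀ k₀ : ℕ, (∀ k, k₀ ≤ k → (c k).shade = (d : ℕ∞)) →
          (∀ k, k₀ ≤ k → Module.finrank K (resVertex (c k)) = e) → False) :
    NoAboveFloorTrap p p :=
  (noAboveFloorTrap_iff_lowTails p).mpr h

end ResCone

end Summit.ResolutionOfSingularities.ResolutionOfSingularities.Theorems.PIDim4

end
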